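import Summits.CriticalPhenomena.CardyFormulaZ2.Theorems.CardyUniqueLimitCardyRigiditySlitCrossingHullBoundary
import Literature.Probability.LatticeModels.DobrushinDiscretisation
import HarnessLib

/-!
# Slit components of the exploration prefixes, uniform local connectedness, the fjord event

Crux `Summit.CriticalPhenomena.CardyFormulaZ2.Theses.CardyUniqueLimit.CardyRigidity`
(stmt-CriticalPhenomena-0746), line `crossing_martingale`, in support of the registered stub A3b
`stub_slitObservableApprox : ∀ f, AllRectangleKernel f → PercSlitObservableApprox f` (the heart;
NOT proved here).  Vocabulary for the REGULARITY of the random slit domains of the bond-`ℤ²`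
exploration (Camia–Newman, PTRF 139 (2007), §6 "Boundary of the hull", Lemmas 6.1–6.4, and the
close-encounter Lemmas 7.1–7.2), in the form consumed by the kernel theorem with uniformly
locally connected complements (`hlc` clause of
`MarkedDomain.exists_uniformizers_of_kernel_of_isChordalUniformizing`,
`Literature/Probability/RandomPlanarGeometry/ChordalUniformizerKernelGiven.lean`):

* `Regularity.ULC ε'' ε U` — the `hlc` clause for ONE open set `U`: any two points of
  `frontier U` at distance `< ε''` lie on a compact connected subset of `Uᶜ` inside
  `closedBall a ε`; `Regularity.ULCOff ε'' ε U V` — the same for the pairs of frontier points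
  OFF an exceptional set `V` (the classical "`E ⊆ S`, `diam E ≤ ε`" form for a set `S` and the
  touching lemmas are in the companion file `…ExplorationULC2.lean`);
* for Dobrushin data `D`, a thickening radius `η`, a depth `n` and a configuration `ω`: the
  prefix polyline `prefixPolyline D n ω` (polyline of `explorationPrefix D n ω = γ[0, n+1]`
  through the medial points), the closed OBSTACLE
  `obstacle D η n ω = cthickening η (range (prefixPolyline D n ω) ∪ (D.Ω)ᶜ)` — the closed
  `η`-neighbourhood of the explored polyline and of the complement of the domain (for `η = 0`
  and `D.Ω` open just their union) —, the SLIT COMPONENTS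
  `slitComponent D η n ω z = connectedComponentIn (obstacle D η n ω)ᶜ z` (the component of the
  reference point `z`; `∅` on the obstacle), open, preconnected, inside `D.Ω`, with
  `frontier (slitComponent …) ⊆ obstacle …` (`frontier_slitComponent_subset`), and the TIP
  `tip D n ω = prefixPolyline D n ω 1` (the last medial point of the prefix); all are class
  functions of the prefix (`…_congr`);
* the FJORD EVENT `fjordEvent D η ε'' ε ρ = {ω | ∃ n z, ¬ ULCOff ε'' ε (slitComponent D η n ω z)
  (ball (tip D n ω) ρ)}` — at some depth some slit component has a NARROW FJORD away from the
  tip —, measurable (`measurableSet_fjordEvent`: a class function of the whole exploration,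
  `measurable_of_medialExploration`) and monotone in the three scales (`fjordEvent_mono`);
* `PercExplorationULCFor D Λ` / `PercExplorationULC` — the sub-goal predicate
  "(ε'', ε)-regularity of the explored slit domains away from the tip, with high probability":
  for all `ε, ρ, r > 0` there are a tube constant `C > 0` and `ε'' > 0` such that along all positive
  meshes `δ_k → 0`, eventually `P_{1/2} (fjordEvent (Λ δ_k) (C δ_k) ε'' ε ρ) ≤ r`
  (Camia–Newman's "close encounters are touchings", Lemma 6.1 and claim (C) of Lemma 6.2 — six
  arms in the bulk —, Lemmas 7.1/7.2 — boundary —; deliberately NOT a Literature fact).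

Design notes (why this exact shape).
1. THE TUBE `η = C δ`.  On the hexagonal lattice "touching" means getting one hexagon away
   (Camia–Newman, before Lemma 7.1).  The bond-`ℤ²` medial polyline touches itself only at revisited
   medial vertices and, generically, NEVER meets `∂Ω`: along the free arc `B` it runs at distance
   `δ/2` from the `B`-sites (midpoints of `B`–`B` edges are never visited), and every site of
   `zdBoundary` is within `√2 δ` of `(D.Ω)ᶜ`.  With `η = 0` every pair (polyline point near `∂Ω`,
   point of `∂Ω`) would be an unclosable fjord (a continuum of `polyline ∪ Ωᶜ` through both would
   meet two disjoint closed sets), with probability `→ 1`.  Thickening both the polyline and `Ωᶜ`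
   by `C δ`, `C ≥ 2`, merges every lattice-scale contact into the obstacle; `C δ → 0`.
2. THE TIP EXCLUSION `ρ`.  One lattice step before the tube about the returning exploration
   merges with the tube about an earlier piece and thereby encloses a pocket of diameter `> 3ε`,
   the two tubes are `< δ` apart: a point `a` of the old tube boundary and a point `b` of the tube
   boundary at the tip are frontier points of the main slit component at distance `< ε''`, the
   pocket is still attached to that component through the gap between them, and no continuum of
   the complement inside `closedBall a ε` joins `a` to `b` (with the explored loop it would
   separate an interior point of the pocket from the far region: the loop closed through the gap
   and the loop closed through the continuum have equal winding numbers off `closedBall a 2ε`).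
   Macroscopic closures occur with probability bounded below uniformly in the mesh, so the
   all-pairs clause `∀ n, ULC ε'' ε (slitComponent …)` fails with probability NOT tending to `0`:
   regularity holds only off a ball about the current tip.  (Consequence for the heart: a uniform
   boundary modulus of the slit uniformizers AT the tip is false at near-closure steps; the pocket
   attached at the tip has conformal size `≤ C'/√log(1/δ)` seen from a far interior point, by
   length–area.)
3. ALL COMPONENTS (`∃ z`): pockets and boundary slivers are included; for a small component `W`
   the clause is weak (`σ ⊆ Wᶜ` may pass through the main component), for the main component it
   is Camia–Newman's regularity of `∂D_{a,b}(z)`.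

References: F. Camia, C. M. Newman, Probab. Theory Relat. Fields 139 (2007) 473–519, §6
(Lemmas 6.1–6.4), §7 (Lemmas 7.1–7.2) [CamiaNewman2007]; Ch. Pommerenke, *Boundary Behaviour of
Conformal Maps* (1992), §2.2–2.3 (uniformly locally connected sets) [PommerenkeBBCM1992].
-/

noncomputable section

open MeasureTheory Set Metric Filter Topology
open scoped ENNReal
open Literature.Probability Literature.Probability.LatticeModels Literature.Probability.Percolation
open Literature.Probability.LatticeModels.DiscreteDobrushin

namespace Summit.CriticalPhenomena.CardyFormulaZ2.Cruxes.CardyRigidity.CrossingMartingale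

namespace Regularity

/-! ### Uniform local connectedness of the complement of an open set -/

/-- **`(ε'', ε)`-uniform local connectedness of the complement, `hlc` form.**  Any two frontier
points of `U` at distance `< ε''` lie on a compact connected subset of `Uᶜ` contained in the
closed `ε`-ball about the first one — verbatim the clause `hlc` of the kernel theorem
`MarkedDomain.exists_uniformizers_of_kernel_of_isChordalUniformizing` for one domain.
[cite: PommerenkeBBCM1992, §2.2] -/
def ULC (ε'' ε : ℝ) (U : Set ℂ) : Prop :=
  ∀ a ∈ frontier U, ∀ b ∈ frontier U, dist a b < ε'' →
    ∃ σ ⊆ Uᶜ, IsCompact σ ∧ IsPreconnected σ ∧ a ∈ σ ∧ b ∈ σ ∧ σ ⊆ closedBall a ε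

/-- **Uniform local connectedness of the complement off an exceptional set `V`**: the clause of
`ULC` for the pairs of frontier points of `U` both outside `V` (below, `V` is a ball about the
tip of the exploration). [cite: PommerenkeBBCM1992, §2.2] -/
def ULCOff (ε'' ε : ℝ) (U V : Set ℂ) : Prop :=
  ∀ a ∈ frontier U \ V, ∀ b ∈ frontier U \ V, dist a b < ε'' →
    ∃ σ ⊆ Uᶜ, IsCompact σ ∧ IsPreconnected σ ∧ a ∈ σ ∧ b ∈ σ ∧ σ ⊆ closedBall a ε

/-- Off the empty set, `ULCOff` is `ULC`. [folklore] -/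
theorem ulcOff_empty_iff {ε'' ε : ℝ} {U : Set ℂ} : ULCOff ε'' ε U ∅ ↔ ULC ε'' ε U := by
  simp [ULCOff, ULC]

/-- `ULC` is `ULCOff` off any set. [folklore] -/
theorem ULC.ulcOff {ε'' ε : ℝ} {U : Set ℂ} (h : ULC ε'' ε U) (V : Set ℂ) : ULCOff ε'' ε U V :=
  fun a ha b hb hab ↦ h a ha.1 b hb.1 hab

/-- `ULCOff` is monotone: fewer pairs (smaller `ε''`, larger exceptional set) and a larger ball
are easier. [folklore] -/
theorem ULCOff.mono {ε₁'' ε₂'' ε₁ ε₂ : ℝ} {U V₁ V₂ : Set ℂ} (h : ULCOff ε₂'' ε₁ U V₁)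
    (h'' : ε₁'' ≤ ε₂'') (hε : ε₁ ≤ ε₂) (hV : V₁ ⊆ V₂) : ULCOff ε₁'' ε₂ U V₂ := by
  intro a ha b hb hab
  obtain ⟨σ, hσU, hσc, hσp, haσ, hbσ, hσball⟩ :=
    h a ⟨ha.1, fun h ↦ ha.2 (hV h)⟩ b ⟨hb.1, fun h ↦ hb.2 (hV h)⟩ (hab.trans_le h'')
  exact ⟨σ, hσU, hσc, hσp, haσ, hbσ, hσball.trans (closedBall_subset_closedBall hε)⟩

/-- `ULC` is monotone in the two scales. [folklore] -/
theorem ULC.mono {ε₁'' ε₂'' ε₁ ε₂ : ℝ} {U : Set ℂ} (h : ULC ε₂'' ε₁ U) (h'' : ε₁'' ≤ ε₂'')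
    (hε : ε₁ ≤ ε₂) : ULC ε₁'' ε₂ U := by
  rw [← ulcOff_empty_iff] at h ⊢
  exact h.mono h'' hε Subset.rfl

/-! ### The prefix polyline, the obstacle, the slit components and the tip -/

variable (D : DiscreteDobrushin)

/-- **The prefix polyline** of depth `n`: the polyline through the medial points (mesh `D.δ`) of
the exploration prefix `explorationPrefix D n ω = γ[0, n+1]`. [cite: CamiaNewman2007, §6] -/
def prefixPolyline (n : ℕ) (ω : BondConfig (Site 2)) : C(unitInterval, ℂ) :=
  polyline ((explorationPrefix D n ω).map (medialPoint D.δ))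

/-- **The obstacle** of depth `n` with tube radius `η`: the closed `η`-neighbourhood of the trace
of the prefix polyline together with the complement of the continuum domain `D.Ω` (for `η = 0`
and `D.Ω` open: just `range (prefixPolyline D n ω) ∪ (D.Ω)ᶜ`).  The tube
`η = C δ` renders every lattice-scale contact of the exploration with itself or with `∂Ω` a
genuine touching (Camia–Newman's convention "touching = one hexagon away"). [cite: CamiaNewman2007, §7 (before Lemma 7.1)] -/
def obstacle (η : ℝ) (n : ℕ) (ω : BondConfig (Site 2)) : Set ℂ :=
  cthickening η (range (prefixPolyline D n ω) ∪ (D.Ω)ᶜ)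

/-- **The slit component** of the reference point `z` at depth `n` (tube radius `η`): the
connected component of `z` in the complement of the obstacle (`∅` if `z` lies on the obstacle).
For `z` ahead of the exploration this is the discrete slit domain `Ω ∖ γ[0, n+1]` seen from `z`,
Camia–Newman's `D_{a,b}(z)`. [cite: CamiaNewman2007, §6 (Lemma 6.2)] -/
def slitComponent (η : ℝ) (n : ℕ) (ω : BondConfig (Site 2)) (z : ℂ) : Set ℂ :=
  connectedComponentIn (obstacle D η n ω)ᶜ z

/-- **The tip** of the prefix of depth `n`: the endpoint of the prefix polyline (the medial point
of the last vertex `γ_{min (n+1) N}` of the prefix). [cite: CamiaNewman2007, §6] -/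
def tip (n : ℕ) (ω : BondConfig (Site 2)) : ℂ :=
  prefixPolyline D n ω 1

variable {D}

/-- The trace of the prefix polyline is compact. [folklore] -/
theorem isCompact_range_prefixPolyline (n : ℕ) (ω : BondConfig (Site 2)) :
    IsCompact (range (prefixPolyline D n ω)) :=
  isCompact_range (prefixPolyline D n ω).continuous

/-- The obstacle is closed. [folklore] -/
theorem isClosed_obstacle (η : ℝ) (n : ℕ) (ω : BondConfig (Site 2)) : IsClosed (obstacle D η n ω) :=
  isClosed_cthickening

/-- The obstacle grows with the tube radius. [folklore] -/
theorem obstacle_mono {η₁ η₂ : ℝ} (h : η₁ ≤ η₂) (n : ℕ) (ω : BondConfig (Site 2)) :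
    obstacle D η₁ n ω ⊆ obstacle D η₂ n ω :=
  cthickening_mono h _

/-- The trace of the prefix polyline is part of the obstacle. [folklore] -/
theorem range_prefixPolyline_subset_obstacle (η : ℝ) (n : ℕ) (ω : BondConfig (Site 2)) :
    range (prefixPolyline D n ω) ⊆ obstacle D η n ω :=
  subset_union_left.trans (self_subset_cthickening _)

/-- The complement of the continuum domain is part of the obstacle. [folklore] -/
theorem compl_subset_obstacle (η : ℝ) (n : ℕ) (ω : BondConfig (Site 2)) : (D.Ω)ᶜ ⊆ obstacle D η n ω :=
  subset_union_right.trans (self_subset_cthickening _)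

/-- Points within `η` of the trace of the prefix polyline are on the obstacle (the tube). [folklore] -/
theorem mem_obstacle_of_dist_le {η : ℝ} {n : ℕ} {ω : BondConfig (Site 2)} {x : ℂ} {t : unitInterval}
    (h : dist x (prefixPolyline D n ω t) ≤ η) : x ∈ obstacle D η n ω :=
  mem_cthickening_of_dist_le x _ η _ (Or.inl ⟨t, rfl⟩) h

/-- Points within `η` of the complement of the domain are on the obstacle (the collar). [folklore] -/
theorem mem_obstacle_of_dist_compl_le {η : ℝ} {n : ℕ} {ω : BondConfig (Site 2)} {x y : ℂ}
    (hy : y ∉ D.Ω) (h : dist x y ≤ η) : x ∈ obstacle D η n ω :=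
  mem_cthickening_of_dist_le x y η _ (Or.inr hy) h

/-- The medial points of the prefix lie on the obstacle. [folklore] -/
theorem medialPoint_mem_obstacle (η : ℝ) {n : ℕ} {ω : BondConfig (Site 2)} {e : MedialVertex}
    (he : e ∈ explorationPrefix D n ω) : medialPoint D.δ e ∈ obstacle D η n ω :=
  range_prefixPolyline_subset_obstacle η n ω (mem_range_polyline (List.mem_map_of_mem he))

/-- The tip lies on the trace of the prefix polyline. [folklore] -/
theorem tip_mem_range (n : ℕ) (ω : BondConfig (Site 2)) : tip D n ω ∈ range (prefixPolyline D n ω) :=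
  ⟨1, rfl⟩

/-- The tip lies on the obstacle. [folklore] -/
theorem tip_mem_obstacle (η : ℝ) (n : ℕ) (ω : BondConfig (Site 2)) : tip D n ω ∈ obstacle D η n ω :=
  range_prefixPolyline_subset_obstacle η n ω (tip_mem_range n ω)

/-- A slit component avoids the obstacle. [folklore] -/
theorem slitComponent_subset_compl (η : ℝ) (n : ℕ) (ω : BondConfig (Site 2)) (z : ℂ) :
    slitComponent D η n ω z ⊆ (obstacle D η n ω)ᶜ :=
  connectedComponentIn_subset _ _

/-- A slit component lies in the continuum domain. [folklore] -/
theorem slitComponent_subset_Ω (η : ℝ) (n : ℕ) (ω : BondConfig (Site 2)) (z : ℂ) :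
    slitComponent D η n ω z ⊆ D.Ω := fun x hx ↦ by
  by_contra h
  exact slitComponent_subset_compl η n ω z hx (compl_subset_obstacle η n ω h)

/-- A slit component avoids the trace of the prefix polyline. [folklore] -/
theorem disjoint_slitComponent_range (η : ℝ) (n : ℕ) (ω : BondConfig (Site 2)) (z : ℂ) :
    Disjoint (slitComponent D η n ω z) (range (prefixPolyline D n ω)) :=
  disjoint_left.2 fun _ hx hr ↦
    slitComponent_subset_compl η n ω z hx (range_prefixPolyline_subset_obstacle η n ω hr)

/-- A slit component is preconnected. [folklore] -/
theorem isPreconnected_slitComponent (η : ℝ) (n : ℕ) (ω : BondConfig (Site 2)) (z : ℂ) :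
    IsPreconnected (slitComponent D η n ω z) :=
  isPreconnected_connectedComponentIn

/-- A slit component is open (the obstacle is closed, the plane is locally connected). [folklore] -/
theorem isOpen_slitComponent (η : ℝ) (n : ℕ) (ω : BondConfig (Site 2)) (z : ℂ) :
    IsOpen (slitComponent D η n ω z) :=
  (isClosed_obstacle η n ω).isOpen_compl.connectedComponentIn

/-- A point off the obstacle lies in its own slit component. [folklore] -/
theorem mem_slitComponent_self {η : ℝ} {n : ℕ} {ω : BondConfig (Site 2)} {z : ℂ}
    (hz : z ∉ obstacle D η n ω) : z ∈ slitComponent D η n ω z :=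
  mem_connectedComponentIn hz

/-- Slit components of points of one component coincide. [folklore] -/
theorem slitComponent_eq_of_mem {η : ℝ} {n : ℕ} {ω : BondConfig (Site 2)} {z w : ℂ}
    (h : w ∈ slitComponent D η n ω z) : slitComponent D η n ω z = slitComponent D η n ω w :=
  connectedComponentIn_eq h

/-- **The frontier of a slit component lies on the obstacle** (and in the closure of the
component): a frontier point off the obstacle would have an open slit component meeting, hence
equal to, the given one. [folklore] -/
theorem frontier_slitComponent_subset (η : ℝ) (n : ℕ) (ω : BondConfig (Site 2)) (z : ℂ) :
    frontier (slitComponent D η n ω z) ⊆ obstacle D η n ω ∩ closure (slitComponent D η n ω z) := by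
  intro y hy
  rw [(isOpen_slitComponent η n ω z).frontier_eq] at hy
  refine ⟨?_, hy.1⟩
  by_contra hyO
  have hopen := isOpen_slitComponent (D := D) η n ω y
  obtain ⟨w, hwy, hwz⟩ := mem_closure_iff.1 hy.1 _ hopen (mem_slitComponent_self hyO)
  have h1 : slitComponent D η n ω z = slitComponent D η n ω w := slitComponent_eq_of_mem hwz
  have h2 : slitComponent D η n ω y = slitComponent D η n ω w := slitComponent_eq_of_mem hwy
  exact hy.2 (h1 ▸ h2 ▸ mem_slitComponent_self hyO)

/-! ### Class functions of the prefix -/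

/-- The prefix polyline is a function of the prefix. [cite: DuminilCopinSmirnov2012Clay, §6.2] -/
theorem prefixPolyline_congr_prefix {n : ℕ} {ω ω' : BondConfig (Site 2)}
    (h : explorationPrefix D n ω = explorationPrefix D n ω') :
    prefixPolyline D n ω = prefixPolyline D n ω' := by
  simp only [prefixPolyline, h]

/-- The prefix polyline is a class function of the whole exploration. [cite: DuminilCopinSmirnov2012Clay, §6.2] -/
theorem prefixPolyline_congr (n : ℕ) {ω ω' : BondConfig (Site 2)}
    (h : medialExploration D ω = medialExploration D ω') :
    prefixPolyline D n ω = prefixPolyline D n ω' :=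
  prefixPolyline_congr_prefix (by simp only [explorationPrefix, h])

/-- The obstacle is a class function of the whole exploration. [cite: DuminilCopinSmirnov2012Clay, §6.2] -/
theorem obstacle_congr (η : ℝ) (n : ℕ) {ω ω' : BondConfig (Site 2)}
    (h : medialExploration D ω = medialExploration D ω') : obstacle D η n ω = obstacle D η n ω' := by
  simp only [obstacle, prefixPolyline_congr n h]

/-- The slit components are class functions of the whole exploration. [cite: DuminilCopinSmirnov2012Clay, §6.2] -/
theorem slitComponent_congr (η : ℝ) (n : ℕ) {ω ω' : BondConfig (Site 2)}
    (h : medialExploration D ω = medialExploration D ω') :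
    slitComponent D η n ω = slitComponent D η n ω' := by
  funext z
  simp only [slitComponent, obstacle_congr η n h]

/-- The tip is a class function of the whole exploration. [cite: DuminilCopinSmirnov2012Clay, §6.2] -/
theorem tip_congr (n : ℕ) {ω ω' : BondConfig (Site 2)}
    (h : medialExploration D ω = medialExploration D ω') : tip D n ω = tip D n ω' := by
  simp only [tip, prefixPolyline_congr n h]

/-! ### The fjord event -/

variable (D)

/-- **The fjord event** at tube radius `η`, scales `(ε'', ε)` and tip-exclusion radius `ρ`: at
some depth `n`, some slit component of the prefix has two frontier points, both at distance
`≥ ρ` from the tip, at mutual distance `< ε''`, lying on no compact connected subset of the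
complement of the component inside the closed `ε`-ball about the first — a NARROW FJORD away
from the tip (a close encounter of the exploration with its past or with `∂Ω` not closed by a
touching). [cite: CamiaNewman2007, §6 (Lemma 6.2) and §7 (Lemmas 7.1–7.2)] -/
def fjordEvent (η ε'' ε ρ : ℝ) : Set (BondConfig (Site 2)) :=
  {ω | ∃ n : ℕ, ∃ z : ℂ, ¬ ULCOff ε'' ε (slitComponent D η n ω z) (ball (tip D n ω) ρ)}

variable {D}

/-- Membership in the fjord event, unfolded. [folklore] -/
theorem mem_fjordEvent_iff {η ε'' ε ρ : ℝ} {ω : BondConfig (Site 2)} :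
    ω ∈ fjordEvent D η ε'' ε ρ ↔
      ∃ n : ℕ, ∃ z : ℂ, ¬ ULCOff ε'' ε (slitComponent D η n ω z) (ball (tip D n ω) ρ) :=
  Iff.rfl

/-- Off the fjord event, every slit component at every depth is `(ε'', ε)`-uniformly locally
connected off the `ρ`-ball about the tip. [folklore] -/
theorem ulcOff_of_not_mem_fjordEvent {η ε'' ε ρ : ℝ} {ω : BondConfig (Site 2)}
    (h : ω ∉ fjordEvent D η ε'' ε ρ) (n : ℕ) (z : ℂ) :
    ULCOff ε'' ε (slitComponent D η n ω z) (ball (tip D n ω) ρ) := by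
  by_contra h'
  exact h ⟨n, z, h'⟩

/-- **The fjord event is monotone in the three scales**: a larger `ε''`, a smaller `ε` and a
smaller exclusion radius give more fjords. [folklore] -/
theorem fjordEvent_mono (η : ℝ) {ε₁'' ε₂'' ε₁ ε₂ ρ₁ ρ₂ : ℝ} (h'' : ε₁'' ≤ ε₂'') (hε : ε₂ ≤ ε₁)
    (hρ : ρ₂ ≤ ρ₁) : fjordEvent D η ε₁'' ε₁ ρ₁ ⊆ fjordEvent D η ε₂'' ε₂ ρ₂ := by
  rintro ω ⟨n, z, hbad⟩
  exact ⟨n, z, fun hgood ↦ hbad (hgood.mono h'' hε (ball_subset_ball hρ))⟩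

/-- **The fjord event is measurable**: it is a class function of the whole medial exploration
(`measurable_of_medialExploration`). [cite: AizenmanBurchard1999, §2.1] -/
theorem measurableSet_fjordEvent (D : DiscreteDobrushin) (η ε'' ε ρ : ℝ) :
    MeasurableSet (fjordEvent D η ε'' ε ρ) :=
  measurableSet_setOf.2 <| measurable_of_medialExploration D fun ω ω' h ↦ by
    simp only [slitComponent_congr _ _ h, tip_congr _ h]

/-! ### The estimate (sub-goal predicates of the route) -/

/-- **(ε'', ε)-regularity of the explored slit domains away from the tip, with high probability,
for ONE family `Λ` of discrete Dobrushin data** (the bond-`ℤ²` transplant of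
Camia–Newman's "close encounters are touchings": PTRF 139 (2007), Lemma 6.1 and claim (C) of
Lemma 6.2 — six disjoint crossings not all of one colour around an interior point of close
approach —, Lemmas 7.1–7.2 — close approach to the boundary —, as used in Lemmas 6.3–6.4 and
Theorem 4 there).  For all `ε, ρ, r > 0` there are a tube constant `C > 0` and a scale `ε'' > 0`
such that along every sequence of positive meshes `δ_k → 0`, eventually in `k`, the
`P_{1/2}`-probability of the fjord event `fjordEvent (Λ δ_k) (C δ_k) ε'' ε ρ` — at some depth some
slit component of the `C δ_k`-thickened explored prefix has two frontier points `ρ`-away from the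
tip, `ε''`-close, not joined in the complement of the component inside an `ε`-ball — is at most
`r`.  The tube and the tip exclusion are both necessary (module docstring, design notes 1–2).
(Sources: Camia–Newman 2007, Lemmas 6.1–6.4, 7.1–7.2; Kesten–Sidoravicius–Zhang 1998 (five arms)
with van den Berg–Kesten–Reimer for the sixth arm; Smirnov–Werner 2001.  A sub-goal of the crux,
stated as a predicate of this route — deliberately NOT a cited Literature fact: the bond-`ℤ²`
statement in this slit-component form is not in print.) -/
def PercExplorationULCFor (Λ : ℝ → DiscreteDobrushin) : Prop :=
  ∀ ε : ℝ, 0 < ε → ∀ ρ : ℝ, 0 < ρ → ∀ r : ℝ, 0 < r → ∃ C ε'' : ℝ, 0 < C ∧ 0 < ε'' ∧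
    ∀ δs : ℕ → ℝ, (∀ k, 0 < δs k) → Tendsto δs atTop (𝓝 0) →
      ∀ᶠ k in atTop,
        bondPercolation (zdGraph 2) half (fjordEvent (Λ (δs k)) (C * δs k) ε'' ε ρ) ≤ ENNReal.ofReal r

/-- **(ε'', ε)-regularity of the explored slit domains away from the tip, with high probability,
along every square-lattice discretisation family of every Dobrushin domain**
(`PercExplorationULCFor` for all families; for non-convex domains the boundary half rests on
Camia–Newman's mushroom Lemma 7.4, itself fed by the continuity of limiting crossing
probabilities).  (Sources: Camia–Newman 2007, Lemmas 6.1–6.4, 7.1–7.4.  A sub-goal of the crux,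
stated as a predicate of this route — deliberately NOT a cited Literature fact.) -/
def PercExplorationULC : Prop :=
  ∀ (D : RandomPlanarGeometry.DobrushinDomain) (Λ : ℝ → DiscreteDobrushin),
    ZdDiscretisationFamily D Λ → PercExplorationULCFor Λ

/-- **Consumer form**: off an event of probability `≤ r` (the fjord event), every slit component of
the `C δ_k`-thickened prefix at every depth is `(ε'', ε)`-uniformly locally connected off the
`ρ`-ball about the tip — the shape of a "good set" clause (`bad` measurable, small, and a sure
statement off `bad`). [cite: CamiaNewman2007, §6] -/
theorem PercExplorationULCFor.goodSet {Λ : ℝ → DiscreteDobrushin} (h : PercExplorationULCFor Λ)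
    {ε ρ r : ℝ} (hε : 0 < ε)
    (hρ : 0 < ρ) (hr : 0 < r) :
    ∃ C ε'' : ℝ, 0 < C ∧ 0 < ε'' ∧ ∀ δs : ℕ → ℝ, (∀ k, 0 < δs k) → Tendsto δs atTop (𝓝 0) →
      ∀ᶠ k in atTop, ∃ bad : Set (BondConfig (Site 2)), MeasurableSet bad ∧
        bondPercolation (zdGraph 2) half bad ≤ ENNReal.ofReal r ∧
        ∀ ω, ω ∉ bad → ∀ (n : ℕ) (z : ℂ),
          ULCOff ε'' ε (slitComponent (Λ (δs k)) (C * δs k) n ω z) (ball (tip (Λ (δs k)) n ω) ρ) := by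
  obtain ⟨C, ε'', hC, hε'', hev⟩ := h ε hε ρ hρ r hr
  refine ⟨C, ε'', hC, hε'', fun δs hpos h0 ↦ (hev δs hpos h0).mono fun k hk ↦ ?_⟩
  exact ⟨fjordEvent (Λ (δs k)) (C * δs k) ε'' ε ρ, measurableSet_fjordEvent _ _ _ _ _, hk,
    fun ω hω n z ↦ ulcOff_of_not_mem_fjordEvent hω n z⟩

/-- The estimate along all families specialises to each family. [folklore] -/
theorem PercExplorationULC.forFamily (h : PercExplorationULC) {D : RandomPlanarGeometry.DobrushinDomain}
    {Λ : ℝ → DiscreteDobrushin} (hΛ : ZdDiscretisationFamily D Λ) : PercExplorationULCFor Λ :=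
  h D Λ hΛ

end Regularity

/-- **Registered form** (anchor `regularity_measurableSet_fjordEvent` of stmt-CriticalPhenomena-0746): for every
discrete Dobrushin datum, tube radius and scales, the fjord event of the exploration — at some depth some slit
component of the thickened prefix polyline has a narrow fjord away from the tip — is a measurable set of bond
configurations. [cite: AizenmanBurchard1999, §2.1] -/
theorem regularity_measurableSet_fjordEvent : ∀ (D : Literature.Probability.LatticeModels.DiscreteDobrushin) (η ε'' ε ρ : ℝ), MeasurableSet (Summit.CriticalPhenomena.CardyFormulaZ2.Cruxes.CardyRigidity.CrossingMartingale.Regularity.fjordEvent D η ε'' ε ρ) :=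
  Regularity.measurableSet_fjordEvent

end Summit.CriticalPhenomena.CardyFormulaZ2.Cruxes.CardyRigidity.CrossingMartingale

end
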